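import Summits.Ventures.PercRepro.GenQTypeTwo

/-!
# PercRepro — C-025 at `(q + 2, q)`: the type-`2` balance at every `q` with the `(q + 2)`-point sets — mine-2's
21.3 threshold in general (night-4, gen 0)

`GenQTypeTwo.lean` closes type `2` for `g ≥ 4q − 3` from the `(q + 1)`-point sets alone.  Adding the
`(q + 2)`-point rank-`q` sets `C` (surplus `σ(C) = q/(1 + m) − Φ ≥ 0`, each containing at most `C(q + 2 − m, 2)`
independent `q`-subsets — every coloop of `M|C` lies in every independent `q`-subset — and each independent
`q`-set lying in `C(g − q, 2)` of them) gives the sharper per-set bound `σ(C) ≥ (κ/2) · C(q + 2 − m(C), 2)`,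
`κ = 2/(3(q − 1)(q + 1))` (`sigma_ge_half_kappa_mul_choose`: the cubic
`(q − 1 − u)(u² − (q + 6)u + 6q(q + 1)) ≥ 0`, `u = 1 + m`), and the balance closes when
`(g − q)(g − q + 3) ≥ 12(q − 1)`:

* **`Jq_two_nonneg'`** — at `q = 4` this is `g ≥ 9`, exactly mine-2's Theorem 21.3 (the landed
  `J_two_nonneg_of_nine_le`); at `q = 5`: `g ≥ 11`; `q = 6`: `g ≥ 13`; in general `g ≥ q + √(12q)` roughly.
-/

namespace PercRepro.GenQ

open Finset ThmH SixFour

variable {α : Type*} [DecidableEq α] {M : Matroid α} [M.Finite]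

/-- The rank-`q` subsets of `G` with exactly `q + 2` points. -/
noncomputable def Nq2 (M : Matroid α) [M.Finite] (G : Finset α) (q : ℕ) : Finset (Finset α) :=
  (Rq M G q).filter (fun B : Finset α => B.card = q + 2)

/-! ## The two injections of the double count for pairs -/

/-- Every independent `q`-subset `B` of `G` lies in at least `C(g − q, 2)` rank-`q` sets with `q + 2` points
(`P ↦ B ∪ P` over the pairs `P ⊆ G ∖ B`). -/
theorem choose_two_le_card_supersets2 {G B : Finset α} {q : ℕ} (hr : M.eRk (G : Set α) = (q : ℕ∞))
    (hB : B ∈ Iq M G q) : (G \ B).card.choose 2 ≤ ((Nq2 M G q).filter (fun C => B ⊆ C)).card := by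
  rw [Iq, Finset.mem_filter, mem_Rq] at hB
  rw [← Finset.card_powersetCard]
  apply Finset.card_le_card_of_injOn (fun P => B ∪ P)
  · intro P hP
    rw [Finset.mem_coe, Finset.mem_powersetCard] at hP
    rw [Finset.mem_coe, Finset.mem_filter, Nq2, Finset.mem_filter, mem_Rq]
    have hPG : P ⊆ G := hP.1.trans Finset.sdiff_subset
    have hsub : B ∪ P ⊆ G := Finset.union_subset hB.1.1 hPG
    have hdisj : Disjoint B P := by
      rw [Finset.disjoint_left]
      intro x hxB hxP
      exact (Finset.mem_sdiff.1 (hP.1 hxP)).2 hxB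
    refine ⟨⟨⟨hsub, ?_⟩, ?_⟩, Finset.subset_union_left⟩
    · apply le_antisymm
      · rw [← hr]
        exact M.eRk_mono (Finset.coe_subset.2 hsub)
      · rw [← hB.1.2]
        exact M.eRk_mono (Finset.coe_subset.2 Finset.subset_union_left)
    · rw [Finset.card_union_of_disjoint hdisj, hB.2, hP.2]
  · intro P hP P' hP' hPP'
    rw [Finset.mem_coe, Finset.mem_powersetCard] at hP hP'
    simp only at hPP'
    have h1 : Disjoint B P := by
      rw [Finset.disjoint_left]
      intro x hxB hxP
      exact (Finset.mem_sdiff.1 (hP.1 hxP)).2 hxB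
    have h2 : Disjoint B P' := by
      rw [Finset.disjoint_left]
      intro x hxB hxP
      exact (Finset.mem_sdiff.1 (hP'.1 hxP)).2 hxB
    have e1 : P = (B ∪ P) \ B := by
      rw [Finset.union_sdiff_left, Finset.sdiff_eq_self_of_disjoint h1.symm]
    have e2 : P' = (B ∪ P') \ B := by
      rw [Finset.union_sdiff_left, Finset.sdiff_eq_self_of_disjoint h2.symm]
    rw [e1, e2, hPP']

/-- A rank-`q` set `C` with `q + 2` points contains at most `C(q + 2 − m(C), 2)` independent `q`-subsets: every
coloop of `M|C` lies in each of them, so `B ↦ C ∖ B` injects them into the pairs of non-coloops. -/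
theorem card_subsets2_le_choose {G C : Finset α} {q : ℕ} (hG : G ⊆ gr M) (hC : C ∈ Nq2 M G q) :
    ((Iq M G q).filter (fun B => B ⊆ C)).card ≤ (q + 2 - mTr M C).choose 2 := by
  rw [Nq2, Finset.mem_filter, mem_Rq] at hC
  have hCg : C ⊆ gr M := hC.1.1.trans hG
  have hsplit := Finset.card_sdiff_add_card_eq_card (coloopsOf_subset (M := M) C)
  have hcardF : (C \ coloopsOf M C).card = q + 2 - mTr M C := by
    unfold mTr
    omega
  rw [← hcardF, ← Finset.card_powersetCard]
  apply Finset.card_le_card_of_injOn (fun B => C \ B)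
  · intro B hB
    rw [Finset.mem_coe, Finset.mem_filter, Iq, Finset.mem_filter, mem_Rq] at hB
    obtain ⟨⟨⟨-, hrB⟩, hcard⟩, hBC⟩ := hB
    rw [Finset.mem_coe, Finset.mem_powersetCard]
    refine ⟨?_, ?_⟩
    · -- `C ∖ B` avoids the coloops: a coloop `y ∉ B` would put `B ⊆ C ∖ {y}` of rank `q − 1`
      intro y hy
      rw [Finset.mem_sdiff] at hy ⊢
      refine ⟨hy.1, fun hycol => ?_⟩
      rw [mem_coloopsOf] at hycol
      have hBsub : B ⊆ C.erase y := by
        intro x hx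
        rw [Finset.mem_erase]
        exact ⟨fun hxy => hy.2 (hxy ▸ hx), hBC hx⟩
      have hyE : y ∈ M.E := by
        rw [← coe_gr M]
        exact_mod_cast hCg hy.1
      have h1 := Matroid.eRk_insert_eq_add_one (M := M) (e := y) (X := ((C.erase y : Finset α) : Set α))
        ⟨hyE, hycol.2⟩
      rw [← Finset.coe_insert, Finset.insert_erase hy.1, hC.1.2] at h1
      have h2 : M.eRk (B : Set α) ≤ M.eRk ((C.erase y : Finset α) : Set α) :=
        M.eRk_mono (Finset.coe_subset.2 hBsub)
      rw [hrB] at h2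
      obtain ⟨k, hk, -⟩ := eRk_eq_nat M (C.erase y)
      rw [hk] at h1 h2
      have h1' : ((q : ℕ) : ℕ∞) = ((k + 1 : ℕ) : ℕ∞) := by push_cast; exact h1
      have h2' : q ≤ k := by exact_mod_cast h2
      have := (Nat.cast_inj (R := ℕ∞)).1 h1'
      omega
    · rw [Finset.card_sdiff_of_subset hBC, hC.2, hcard]
      omega
  · intro B hB B' hB' hBB'
    rw [Finset.mem_coe, Finset.mem_filter] at hB hB'
    simp only at hBB'
    rw [← Finset.sdiff_sdiff_eq_self hB.2, ← Finset.sdiff_sdiff_eq_self hB'.2, hBB']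

/-! ## The surplus of a `(q + 2)`-point set -/

/-- `σ(C) = q/(1 + c) − (q + 2)/(q + 1) ≥ (κ/2) · C(q + 2 − c, 2)` for `0 ≤ c ≤ q − 2`, `q ≥ 2`. -/
theorem sigma_ge_half_kappa_mul_choose {q c : ℕ} (hq : 2 ≤ q) (hc : c + 2 ≤ q) :
    (2 / (3 * ((q : ℚ) - 1) * ((q : ℚ) + 1)) / 2) * ((q + 2 - c).choose 2 : ℚ) ≤
      (q : ℚ) / (1 + (c : ℚ)) - ((q : ℚ) + 2) / ((q : ℚ) + 1) := by
  have hq' : (2 : ℚ) ≤ q := by exact_mod_cast hq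
  have hc' : (c : ℚ) + 2 ≤ q := by exact_mod_cast hc
  have hc0 : (0 : ℚ) ≤ c := by positivity
  have h1 : (0 : ℚ) < (q : ℚ) - 1 := by linarith
  have h2 : (0 : ℚ) < (q : ℚ) + 1 := by linarith
  have h3 : (0 : ℚ) < 1 + (c : ℚ) := by linarith
  rw [Nat.cast_choose_two]
  have hcast : ((q + 2 - c : ℕ) : ℚ) = (q : ℚ) + 2 - c := by
    rw [Nat.cast_sub (by omega)]
    push_cast
    ring
  rw [hcast]
  rw [← sub_nonneg]
  have e : (q : ℚ) / (1 + (c : ℚ)) - ((q : ℚ) + 2) / ((q : ℚ) + 1) -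
      (2 / (3 * ((q : ℚ) - 1) * ((q : ℚ) + 1)) / 2) * (((q : ℚ) + 2 - c) * ((q : ℚ) + 2 - c - 1) / 2) =
      (((q : ℚ) - 1 - (1 + c)) * ((1 + (c : ℚ)) ^ 2 - ((q : ℚ) + 6) * (1 + c) + 6 * (q : ℚ) * ((q : ℚ) + 1))) /
        (6 * ((q : ℚ) - 1) * ((q : ℚ) + 1) * (1 + (c : ℚ))) := by
    field_simp
    ring
  rw [e]
  apply div_nonneg
  · apply mul_nonneg
    · linarith
    · nlinarith [sq_nonneg (2 * (1 + (c : ℚ)) - ((q : ℚ) + 6))]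
  · positivity

/-! ## The type-`2` balance with the 21.3 threshold -/

/-- **The type-`2` balance at every `q`, with mine-2's 21.3 threshold**: for a simple matroid and a rank-`q` set
`G` with `g` points, `q ≥ 2` and `(g − q)(g − q + 3) ≥ 12(q − 1)`, `0 ≤ Jq M G q 2`.  At `q = 4` this is `g ≥ 9`. -/
theorem Jq_two_nonneg' (hs : Simple M) {G : Finset α} {q : ℕ} (hG : G ⊆ gr M)
    (hr : M.eRk (G : Set α) = (q : ℕ∞)) (hq : 2 ≤ q) (hg : 12 * (q - 1) ≤ (G.card - q) * (G.card - q + 3)) :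
    0 ≤ Jq M G q 2 := by
  classical
  set Φ : ℚ := ((q : ℚ) + 2) / ((q : ℚ) + 1) with hΦ
  set κ : ℚ := 2 / (3 * ((q : ℚ) - 1) * ((q : ℚ) + 1)) with hκ
  have hq' : (2 : ℚ) ≤ q := by exact_mod_cast hq
  have hq1 : (0 : ℚ) < (q : ℚ) - 1 := by linarith
  have hq2 : (0 : ℚ) < (q : ℚ) + 1 := by linarith
  have hκ0 : 0 ≤ κ := by rw [hκ]; positivity
  -- the four kinds of rank-`q` sets
  set I := Iq M G q with hI
  set N1 := Nq1 M G q with hN1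
  set N2 := Nq2 M G q with hN2
  set Rest := (((Rq M G q).filter (fun B : Finset α => ¬ B.card = q)).filter
    (fun B : Finset α => ¬ B.card = q + 1)).filter (fun B : Finset α => ¬ B.card = q + 2) with hRest
  have hsplit : ∑ B ∈ Rq M G q, ((q : ℚ) * wInf M B - Φ) =
      ∑ B ∈ I, ((q : ℚ) * wInf M B - Φ) + (∑ B ∈ N1, ((q : ℚ) * wInf M B - Φ) +
        (∑ B ∈ N2, ((q : ℚ) * wInf M B - Φ) + ∑ B ∈ Rest, ((q : ℚ) * wInf M B - Φ))) := by
    rw [hI, hN1, hN2, hRest, Iq, Nq1, Nq2]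
    rw [← Finset.sum_filter_add_sum_filter_not (Rq M G q) (fun B : Finset α => B.card = q)]
    congr 1
    rw [← Finset.sum_filter_add_sum_filter_not ((Rq M G q).filter (fun B : Finset α => ¬ B.card = q))
      (fun B : Finset α => B.card = q + 1)]
    congr 1
    · apply Finset.sum_congr _ (fun _ _ => rfl)
      ext B
      simp only [Finset.mem_filter, mem_Rq]
      constructor
      · rintro ⟨⟨h1, h2⟩, h3⟩
        exact ⟨h1, h3⟩
      · rintro ⟨h1, h3⟩
        exact ⟨⟨h1, by omega⟩, h3⟩
    rw [← Finset.sum_filter_add_sum_filter_not (((Rq M G q).filter (fun B : Finset α => ¬ B.card = q)).filter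
      (fun B : Finset α => ¬ B.card = q + 1)) (fun B : Finset α => B.card = q + 2)]
    congr 1
    apply Finset.sum_congr _ (fun _ _ => rfl)
    ext B
    simp only [Finset.mem_filter, mem_Rq]
    constructor
    · rintro ⟨⟨⟨h1, h2⟩, h3⟩, h4⟩
      exact ⟨h1, h4⟩
    · rintro ⟨h1, h4⟩
      exact ⟨⟨⟨h1, by omega⟩, by omega⟩, h4⟩
  -- (I) the independent `q`-sets: deficit `2/(q + 1)` each
  have hIsum : (I.card : ℚ) * (-(2 / ((q : ℚ) + 1))) ≤ ∑ B ∈ I, ((q : ℚ) * wInf M B - Φ) := by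
    rw [← nsmul_eq_mul]
    apply Finset.card_nsmul_le_sum
    intro B hB
    rw [hI, Iq, Finset.mem_filter, mem_Rq] at hB
    have hw := wInf_ge_of_eRk_eq (hB.1.1.trans hG) hB.1.2
    have hq0 : (0 : ℚ) ≤ q := by positivity
    have : (q : ℚ) * (1 / ((q : ℚ) + 1)) ≤ (q : ℚ) * wInf M B := mul_le_mul_of_nonneg_left hw hq0
    have e : (q : ℚ) * (1 / ((q : ℚ) + 1)) - Φ = -(2 / ((q : ℚ) + 1)) := by
      rw [hΦ]
      field_simp
      ring
    linarith
  -- (N1) the `(q + 1)`-point sets: surplus `≥ κ · i_q(C)`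
  have hN1sum : ∑ C ∈ N1, κ * ((q : ℚ) + 1 - mTr M C) ≤ ∑ B ∈ N1, ((q : ℚ) * wInf M B - Φ) := by
    apply Finset.sum_le_sum
    intro C hC
    rw [hN1, Nq1, Finset.mem_filter, mem_Rq] at hC
    have hm := mTr_add_two_le_of_simple hs (by omega) (hC.1.1.trans hG) hC.1.2 (by omega)
    have h := sigma_ge_kappa_mul hq hm
    unfold wInf
    rw [hΦ, hκ, mul_one_div]
    exact h
  -- (N2) the `(q + 2)`-point sets: surplus `≥ (κ/2) · C(q + 2 − m, 2)`
  have hN2sum : ∑ C ∈ N2, (κ / 2) * (((q + 2 - mTr M C).choose 2 : ℕ) : ℚ) ≤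
      ∑ B ∈ N2, ((q : ℚ) * wInf M B - Φ) := by
    apply Finset.sum_le_sum
    intro C hC
    rw [hN2, Nq2, Finset.mem_filter, mem_Rq] at hC
    have hm := mTr_add_two_le_of_simple hs (by omega) (hC.1.1.trans hG) hC.1.2 (by omega)
    have h := sigma_ge_half_kappa_mul_choose hq hm
    unfold wInf
    rw [hΦ, hκ, mul_one_div]
    exact h
  -- (Rest) the larger sets: surplus `≥ 0`
  have hRestsum : 0 ≤ ∑ B ∈ Rest, ((q : ℚ) * wInf M B - Φ) := by
    apply Finset.sum_nonneg
    intro B hB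
    rw [hRest, Finset.mem_filter, Finset.mem_filter, Finset.mem_filter, mem_Rq] at hB
    have hcard : q + 1 ≤ B.card := by
      have h4 := M.eRk_le_encard (B : Set α)
      rw [hB.1.1.1.2, Set.encard_coe_eq_coe_finsetCard] at h4
      have h4' : q ≤ B.card := by exact_mod_cast h4
      omega
    have hw := wInf_ge_of_succ_le_card hs (by omega) (hB.1.1.1.1.trans hG) hB.1.1.1.2 hcard
    have hq0 : (0 : ℚ) ≤ q := by positivity
    have : (q : ℚ) * (1 / ((q : ℚ) - 1)) ≤ (q : ℚ) * wInf M B := mul_le_mul_of_nonneg_left hw hq0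
    have e : Φ ≤ (q : ℚ) * (1 / ((q : ℚ) - 1)) := by
      rw [hΦ, div_le_iff₀ hq2, mul_one_div, div_mul_eq_mul_div, le_div_iff₀ hq1]
      nlinarith
    linarith
  -- the double counts
  have hgq : q ≤ G.card := by
    have h4 := M.eRk_le_encard (G : Set α)
    rw [hr, Set.encard_coe_eq_coe_finsetCard] at h4
    exact_mod_cast h4
  have hdc1 : (I.card : ℚ) * ((G.card : ℚ) - q) ≤ ∑ C ∈ N1, ((q : ℚ) + 1 - mTr M C) := by
    have h1 : ∑ B ∈ I, ((G \ B).card : ℚ) ≤ ∑ B ∈ I, ((N1.filter (fun C => B ⊆ C)).card : ℚ) := by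
      apply Finset.sum_le_sum
      intro B hB
      exact_mod_cast card_sdiff_le_card_supersets hr hB
    have h2 : ∑ B ∈ I, ((N1.filter (fun C => B ⊆ C)).card : ℚ) =
        ∑ C ∈ N1, ((I.filter (fun B => B ⊆ C)).card : ℚ) := by
      simp only [Finset.card_filter]
      push_cast
      exact Finset.sum_comm
    have h3 : ∑ C ∈ N1, ((I.filter (fun B => B ⊆ C)).card : ℚ) ≤ ∑ C ∈ N1, ((q : ℚ) + 1 - mTr M C) := by
      apply Finset.sum_le_sum
      intro C hC
      have h := card_subsets_add_mTr_le hG hC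
      have h' : (((I.filter (fun B => B ⊆ C)).card : ℕ) : ℚ) + (mTr M C : ℚ) ≤ (q : ℚ) + 1 := by
        exact_mod_cast h
      linarith
    have h0 : ∑ B ∈ I, ((G \ B).card : ℚ) = (I.card : ℚ) * ((G.card : ℚ) - q) := by
      rw [Finset.card_eq_sum_ones I, Nat.cast_sum, Finset.sum_mul]
      apply Finset.sum_congr rfl
      intro B hB
      rw [hI, Iq, Finset.mem_filter, mem_Rq] at hB
      rw [Finset.card_sdiff_of_subset hB.1.1, Nat.cast_sub (Finset.card_le_card hB.1.1), hB.2]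
      push_cast
      ring
    linarith
  have hdc2 : (I.card : ℚ) * (((G.card - q).choose 2 : ℕ) : ℚ) ≤
      ∑ C ∈ N2, (((q + 2 - mTr M C).choose 2 : ℕ) : ℚ) := by
    have h1 : ∑ B ∈ I, (((G \ B).card.choose 2 : ℕ) : ℚ) ≤ ∑ B ∈ I, ((N2.filter (fun C => B ⊆ C)).card : ℚ) := by
      apply Finset.sum_le_sum
      intro B hB
      exact_mod_cast choose_two_le_card_supersets2 hr hB
    have h2 : ∑ B ∈ I, ((N2.filter (fun C => B ⊆ C)).card : ℚ) =
        ∑ C ∈ N2, ((I.filter (fun B => B ⊆ C)).card : ℚ) := by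
      simp only [Finset.card_filter]
      push_cast
      exact Finset.sum_comm
    have h3 : ∑ C ∈ N2, ((I.filter (fun B => B ⊆ C)).card : ℚ) ≤
        ∑ C ∈ N2, (((q + 2 - mTr M C).choose 2 : ℕ) : ℚ) := by
      apply Finset.sum_le_sum
      intro C hC
      exact_mod_cast card_subsets2_le_choose hG hC
    have h0 : ∑ B ∈ I, (((G \ B).card.choose 2 : ℕ) : ℚ) = (I.card : ℚ) * (((G.card - q).choose 2 : ℕ) : ℚ) := by
      rw [Finset.card_eq_sum_ones I, Nat.cast_sum, Finset.sum_mul]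
      apply Finset.sum_congr rfl
      intro B hB
      rw [hI, Iq, Finset.mem_filter, mem_Rq] at hB
      rw [Finset.card_sdiff_of_subset hB.1.1, hB.2]
      push_cast
      ring
    linarith
  -- assemble
  have hDF : (0 : ℚ) ≤ (DFq M G q 2 : ℚ) := by positivity
  have hΦ0 : 0 ≤ Φ := by rw [hΦ]; positivity
  have hJ : ∑ B ∈ Rq M G q, ((q : ℚ) * wInf M B - Φ) ≤ Jq M G q 2 := by
    unfold Jq Nq
    rw [Finset.sum_sub_distrib, Finset.sum_const, nsmul_eq_mul]
    have : (0 : ℚ) ≤ Φ * (DFq M G q 2 : ℚ) := mul_nonneg hΦ0 hDF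
    have e : ∑ B ∈ Rq M G q, ((q : ℚ) + 2 - ((2 : ℕ) : ℚ)) * wInf M B = ∑ B ∈ Rq M G q, (q : ℚ) * wInf M B := by
      apply Finset.sum_congr rfl
      intro B _
      push_cast
      ring
    rw [e, hΦ]
    linarith
  have hκsum1 : κ * ((I.card : ℚ) * ((G.card : ℚ) - q)) ≤ ∑ C ∈ N1, κ * ((q : ℚ) + 1 - mTr M C) := by
    rw [← Finset.mul_sum]
    exact mul_le_mul_of_nonneg_left hdc1 hκ0
  have hκsum2 : (κ / 2) * ((I.card : ℚ) * (((G.card - q).choose 2 : ℕ) : ℚ)) ≤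
      ∑ C ∈ N2, (κ / 2) * (((q + 2 - mTr M C).choose 2 : ℕ) : ℚ) := by
    rw [← Finset.mul_sum]
    exact mul_le_mul_of_nonneg_left hdc2 (by positivity)
  -- the threshold: `x(x + 3) ≥ 12(q − 1)` with `x = g − q`
  have hx : ((G.card - q : ℕ) : ℚ) = (G.card : ℚ) - q := by
    rw [Nat.cast_sub hgq]
  have hg' : 12 * ((q : ℚ) - 1) ≤ ((G.card : ℚ) - q) * ((G.card : ℚ) - q + 3) := by
    have h := (Nat.cast_le (α := ℚ)).2 hg
    push_cast [Nat.cast_sub hgq, Nat.cast_sub (by omega : 1 ≤ q)] at h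
    linarith
  have hchoose : (((G.card - q).choose 2 : ℕ) : ℚ) = ((G.card : ℚ) - q) * ((G.card : ℚ) - q - 1) / 2 := by
    rw [Nat.cast_choose_two, hx]
  have hfinal : 0 ≤ (I.card : ℚ) * (-(2 / ((q : ℚ) + 1))) + κ * ((I.card : ℚ) * ((G.card : ℚ) - q)) +
      (κ / 2) * ((I.card : ℚ) * (((G.card - q).choose 2 : ℕ) : ℚ)) := by
    have hx0 : (0 : ℚ) ≤ I.card := by positivity
    rw [hchoose]
    have e : (I.card : ℚ) * (-(2 / ((q : ℚ) + 1))) + κ * ((I.card : ℚ) * ((G.card : ℚ) - q)) +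
        (κ / 2) * ((I.card : ℚ) * (((G.card : ℚ) - q) * ((G.card : ℚ) - q - 1) / 2)) =
        (I.card : ℚ) * (((G.card : ℚ) - q) * ((G.card : ℚ) - q + 3) - 12 * ((q : ℚ) - 1)) /
          (6 * ((q : ℚ) - 1) * ((q : ℚ) + 1)) := by
      rw [hκ]
      field_simp
      ring
    rw [e]
    apply div_nonneg
    · apply mul_nonneg hx0
      linarith
    · positivity
  linarith [hsplit, hIsum, hN1sum, hN2sum, hRestsum, hκsum1, hκsum2, hfinal, hJ]

end PercRepro.GenQ
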